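import Mathlib
import Summits.NavierStokesRegularity.NavierStokesRegularity.Theorems.EulerZoomLiouvillePowerGaugeEulerLiouvilleAxisymSlowDrifting
import Summits.NavierStokesRegularity.NavierStokesRegularity.Theorems.EulerZoomLiouvillePowerGaugeEulerLiouvilleClassIsometryTransport
import HarnessLib

/-!
# Crux `EulerZoomLiouville.PowerGaugeEulerLiouville` (stmt-NavierStokesRegularity-19832), `stub_nonSelfSimilarRest`:
# THE CLASSICAL AXISYMMETRIC SLOW-DRIFTING STRATUM (WITH SWIRL) IS EMPTY ABOUT ANY AXIS (width seat ns-ezl-w1 g10, sequel of KEY W1-AX2)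

Route №10 `EulerZoomLiouville` (NavierStokesRegularity), crux E = stmt-NavierStokesRegularity-19832; LEAD ns-typeII-p2 g16.

The binder `¬ IsAxisymSlowDrifting ρ u p` of `stub_nonSelfSimilarRest` (classical on the open past, axisymmetric velocity AND pressure slices about
the FIXED `x₃`-axis — swirl allowed —, drift envelope `‖u(τ,x)‖ ≤ M(−τ)^{−κ}` with `(1−ρ)/(2−ρ) < κ < 1`) is filled by
`AxisymSlowDrifting.ae_eq_zero_of_gauge_of_axisymSlowDrifting'`.  Seregin's class is `O(3)`-invariant (`ClassIsometry.ae_eq_zero_of_conj`, ns-ezl-w1 g10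
over ns-ezl-w2 g3's `…ClassIsometry`), so the same stratum about ANY axis through the blow-up point is empty:

* ★ `AxisymSlowDrifting.ae_eq_zero_of_gauge_of_axisymSlowDrifting_anyAxis (hρ) (hρh) (hsw) (hH) (hgauge) (R) (hstr')` — crux binders verbatim + for
  some linear isometry `R` of `ℝ³` the CONJUGATED pair `u′ = (τ, x) ↦ R u(τ, R⁻¹ x)`, `p′ = (τ, x) ↦ p(τ, R⁻¹ x)` satisfies the three clauses of
  `IsAxisymSlowDrifting ρ u′ p′` (written literally) ⇒ `u = 0` a.e. on the past slab.  (The drift clause is conjugation-invariant; it is kept in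
  the substituted form so that the binder `¬ ∃ R, IsAxisymSlowDrifting ρ u′ p′` is filled by `obtain ⟨R, h⟩; exact … R h`.)

WHAT THIS IS NOT: not NS, not E, not the crux: a widening (fixed axis → any axis) of an already killed classical stratum; 19832 OPEN; no summit statement
is proved by this file.
[cite: CaffarelliKohnNirenberg1982, §2; MajdaBertozziCUP2002, §1.2 Prop. 1.1 (iii)]
-/

noncomputable section

-- flat `Theorems/<Route><Decl>…` files of one crux share the namespace of the crux (tree convention)
set_option linter.dupNamespace false

open MeasureTheory Set Filter Topology Metric Function
open scoped NNReal ENNReal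

namespace Summit.NavierStokesRegularity.NavierStokesRegularity.Theorems.PowerGaugeEulerLiouville.AxisymSlowDrifting

open Literature.Analysis Literature.Analysis.FluidPDE
open Summit.NavierStokesRegularity.NavierStokesRegularity.Theorems.PowerGaugeEulerLiouville

variable {u : ℝ → EuclideanSpace ℝ (Fin 3) → EuclideanSpace ℝ (Fin 3)} {p : ℝ → EuclideanSpace ℝ (Fin 3) → ℝ}
  {H : ℝ → EuclideanSpace ℝ (Fin 3) → EuclideanSpace ℝ (Fin 3) →L[ℝ] EuclideanSpace ℝ (Fin 3)} {c : ℝ≥0}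

/-- ★ **CLASSICAL AXISYMMETRIC SLOW-DRIFTING MEMBERS ARE TRIVIAL ABOUT ANY AXIS** (`0 < ρ ≤ ½`): crux hypotheses verbatim (suitable weak Euler on the
past slab, weak gradient `H`, power gauges `≤ c`) + for some linear isometry `R` of `ℝ³`, the conjugated pair `u′ = (τ, x) ↦ R u(τ, R⁻¹ x)`,
`p′ = (τ, x) ↦ p(τ, R⁻¹ x)` is classical Euler on `(−∞,0)` with axisymmetric velocity and pressure slices and obeys the drift envelope
`‖u′(τ,x)‖ ≤ M(−τ)^{−κ}`, `(1−ρ)/(2−ρ) < κ < 1` (the three clauses of `IsAxisymSlowDrifting ρ u′ p′`, written literally) ⇒ `u = 0` a.e. on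
`(−∞,0) × ℝ³`.  Proof: `ClassIsometry.ae_eq_zero_of_conj` ∘ `ae_eq_zero_of_gauge_of_axisymSlowDrifting'`. [folklore] -/
theorem ae_eq_zero_of_gauge_of_axisymSlowDrifting_anyAxis {ρ : ℝ} (hρ : 0 < ρ) (hρh : ρ ≤ 1 / 2)
    (hsw : IsSuitableWeakSolutionOn (slab (EuclideanSpace ℝ (Fin 3)) (Iio 0) isOpen_Iio) 0 0 u p)
    (hH : HasWeakSpatialGradientOn (slab (EuclideanSpace ℝ (Fin 3)) (Iio 0) isOpen_Iio) u H)
    (hgauge : ∀ a : ℝ, 0 < a →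
      ENNReal.ofReal (a ^ (2 * ρ)) * cknA a (0 : ℝ × EuclideanSpace ℝ (Fin 3)) u +
          ENNReal.ofReal (a ^ ρ) * cknE a (0 : ℝ × EuclideanSpace ℝ (Fin 3)) H +
        ENNReal.ofReal (a ^ (2 * ρ)) * cknD a (0 : ℝ × EuclideanSpace ℝ (Fin 3)) p ≤ (c : ℝ≥0∞))
    (R : EuclideanSpace ℝ (Fin 3) ≃ₗᵢ[ℝ] EuclideanSpace ℝ (Fin 3))
    (hstr' : IsClassicalEulerSolutionOn (Iio 0) 0 (fun τ x => R (u τ (R.symm x))) (fun τ x => p τ (R.symm x)) ∧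
      (∀ τ : ℝ, τ < 0 →
        IsAxisymmetric ((fun τ x => R (u τ (R.symm x))) τ) ∧ IsAxisymmetricScalar ((fun τ x => p τ (R.symm x)) τ)) ∧
      ∃ M κ : ℝ, 0 ≤ M ∧ (1 - ρ) / (2 - ρ) < κ ∧ κ < 1 ∧
        ∀ τ : ℝ, τ < 0 → ∀ x : EuclideanSpace ℝ (Fin 3), ‖(fun τ x => R (u τ (R.symm x))) τ x‖ ≤ M * (-τ) ^ (-κ)) :
    uncurry u =ᵐ[volume.restrict (Iio (0 : ℝ) ×ˢ (univ : Set (EuclideanSpace ℝ (Fin 3))))] 0 := by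
  -- transport the class binders to the conjugated member (`ClassIsometry.ae_eq_zero_of_conj`), then kill it by the fixed-axis member
  refine ClassIsometry.ae_eq_zero_of_conj hsw hH hgauge R ?_
  intro u' p' H' hsw' hH' hg' hu' hp'
  subst hu' hp'
  exact ae_eq_zero_of_gauge_of_axisymSlowDrifting' hρ hρh hsw' hH' hg' hstr'

end Summit.NavierStokesRegularity.NavierStokesRegularity.Theorems.PowerGaugeEulerLiouville.AxisymSlowDrifting

end
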